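import Summits.Ventures.PackingBounds.Configurations.Dim22Card100
import Summits.Ventures.PackingBounds.Configurations.Dim21Card112
import Summits.Ventures.PackingBounds.Configurations.Dim21Card162
import Summits.Ventures.PackingBounds.Configurations.ListConfigKeys
import Summits.Ventures.PackingBounds.SphericalCodes.DimensionLift

/-!
# Derived codes of the Higman–Sims and McLaughlin configurations: `A(21, arccos 1/11) ≥ 77`, `A(19, arccos 1/11) ≥ 60`, …

Framing: lottery ticket; floor = certified bounds/negative ranges. Venture `PackingBounds` (cell `pub-packcert`, seat
`pub-packcert-sdp`), ATTAINED side of the B2c LP-gap cells `(21, 1/11)`, `(20, 1/11)`, `(19, 1/11)`, `(18, 1/11)`,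
`(18, 1/10)` (certified three-point values `89`, `80`, `71`, `64`, `75`; no attained entry so far beyond the cross-polytope
`2n` and lifts of the `13`-dimensional sweep codes). Device (Conway–Sloane Ch. 14 Example 3, the Leech chain
`4600 → 891 → 336 → 170`; Delsarte–Goethals–Seidel "derived codes"): for a code `C` of unit vectors, `x ∈ C` and a
value `t`, the points `y ∈ C` with `⟨x, y⟩ = t`, projected orthogonally to `x`, form a code one dimension lower with
cosines `(β - t²)/(1 - t²)`. Sources, all Leech-lattice sections already in the tree as integer rows of `ℤ²⁴` with
normals (`Config.exists_section`): the Higman–Sims `100` points of `ℝ²²` (`Config.Dim22Card100`, cosines `1/11, -4/11`),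
the McLaughlin-derived `112` points of `ℝ²¹` (`Config.Dim21Card112`, `1/9, -1/3`) and `162` points of `ℝ²¹`
(`Config.Dim21Card162`, `1/7, -2/7`). Rows are DERIVED from those lists by `filter`/`map` (the projection made integral:
`(1/t')·y - x`-type combinations), normals = the source normals plus the base points' projections; all checks by `decide`.
* HS, `x = vecs[0]`, `t = 1/11` (the `77` non-neighbours): rows `11y - x`, squared length `52800`, dot products
  `4400` (`60` times) / `-19800` (`16`), cosines `1/12, -3/8` — **`A(21, arccos 1/11) ≥ 77`** (`exists_code_dim21_eleventh_77`);
* `112`, base points `vecs[0], vecs[1]` (`t = 1/9`, then `1/10`): `60` rows `10z - x₁ - x₂`, squared length `7040`, dot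
  products `640` (`45`) / `-2560` (`14`), cosines `1/11, -4/11` — **`A(19, arccos 1/11) ≥ 60`**, and with two poles
  **`A(20, arccos 1/11) ≥ 62`**; a third step (`vecs[2]`, `t = 1/11`): `45` rows `11w - x₁ - x₂ - x₃`, squared length
  `8448`, keys `704, -3168` (cosines `1/12, -3/8`; three row classes, `ListConfigKeys`) — **`A(18, arccos 1/11) ≥ 45`**;
* `162`, base points `vecs[0..2]` (`t = 1/7, 1/8, 1/9`): `51` rows `9w - x₁ - x₂ - x₃`, squared length `12960`, keys
  `1296, -4536` (cosines `1/10, -7/20`) — **`A(18, arccos 1/10) ≥ 51`**.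
Kernel brackets (attained side only; upper sides are exact three-point certificates of the cell, not kernel theorems).

## References
* J. H. Conway, N. J. A. Sloane, *Sphere Packings, Lattices and Groups*, 3rd ed., Ch. 14 Example 3 (derived spherical
  codes from the Leech lattice), Ch. 10 §3.5 (Higman–Sims and McLaughlin sections). [`ConwaySloane1999`]
* H. Cohn, A. Kumar, *Universally optimal distribution of points on spheres*, J. Amer. Math. Soc. 20 (2007), Table 1
  (the `100`-, `112`-, `162`-point sharp configurations). [`CohnKumar2006`]
-/

namespace Summit.Ventures.PackingBounds.Config

open Finset

variable {R : Type*} [CommRing R] [DecidableEq R] {ι : R →+* ℝ} {m : ℕ} {q : R} {L : List (List R)} {K : List R}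

/-- **Section transfer, key-list version.** A list configuration in `ℝᵐ` passing the shape check and the KEY check
(`keysRowsOK`, no common histogram needed), orthogonal to `k = |S|` pairwise-orthogonal nonzero normals, with
`m = n + k`, yields `|L|` unit vectors of `ℝⁿ` with pairwise inner products `≤ s` as soon as every key is. -/
theorem exists_section_keys (hι : Function.Injective ι) (hq : 0 < ι q) (hS : shapeOK L m q = true)
    (hK : keysRowsOK L K L = true) (hqK : q ∉ K) (S : List (List R)) (hSn : normalsOK S m = true)
    (hO : orthOK S L = true) {n : ℕ} (hm : m = n + S.length) (s : ℝ) (hs : ∀ k ∈ K, ι k / ι q ≤ s) :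
    ∃ C' : Finset (EuclideanSpace ℝ (Fin n)), C'.card = L.length ∧ (∀ x ∈ C', ‖x‖ = 1) ∧
      ∀ x ∈ C', ∀ y ∈ C', x ≠ y → inner ℝ x y ≤ s := by
  obtain ⟨C', hcard, hnorm, hinner, _⟩ := exists_transfer_orthogonal hm
    (fun i : Fin S.length => vec ι m q S[(i : ℕ)]) (linearIndependent_normals hι hq S hSn)
    (config ι m q L) (inner_normals_eq_zero hq hS S hSn hO)
  refine ⟨C', ?_, ?_, ?_⟩
  · rw [hcard, card_eq_keys hι hq hS hK hqK]
  · intro x' hx'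
    obtain ⟨x, hx, he⟩ := hnorm x' hx'
    rw [he]
    exact norm_eq_one hq hS x hx
  · intro x' hx' y' hy' hne
    obtain ⟨x, hx, y, hy, hxy, he⟩ := hinner x' hx' y' hy' hne
    rw [he]
    exact inner_le_keys hq hS hK s hs x hx y hy hxy

end Summit.Ventures.PackingBounds.Config

namespace Summit.Ventures.PackingBounds.Config.LeechDerived

open Finset Summit.Ventures.PackingBounds.Config

/-- Pointwise `a·y - w` of two coordinate lists. -/
def comb (a : ℤ) (y w : List ℤ) : List ℤ := List.zipWith (fun u v => a * u - v) y w

/-- Pointwise sum of two coordinate lists. -/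
def addL (v w : List ℤ) : List ℤ := List.zipWith (· + ·) v w

/-! ## Higman–Sims: the `77` non-neighbours, `A(21, arccos 1/11) ≥ 77` -/

/-- The base point: the first Higman–Sims row. -/
def xHS : List ℤ := Dim22Card100.vecs.getD 0 []

/-- Rows `11y - x` for the `77` Higman–Sims rows `y` with `x·y = 40` (cosine `1/11`). -/
def rows77 : List (List ℤ) := (Dim22Card100.vecs.filter fun y => dotL xHS y == 40).map fun y => comb 11 y xHS

/-- Distance table of the `77`-point code at squared length `52800`: `4400` (`60` times), `-19800` (`16` times). -/
def table77 : List (ℤ × ℕ) := [(4400, 60), (-19800, 16)]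

/-- Normals: the two Higman–Sims normals and the base point. -/
def normals77 : List (List ℤ) := Dim22Card100.normals ++ [xHS]

/-- Kernel check: `77` rows. -/
theorem length_rows77 : rows77.length = 77 := by decide +kernel

set_option maxRecDepth 100000 in
/-- Kernel check: rows of length `24`, self-product `52800`. -/
theorem shape_rows77 : shapeOK rows77 24 (52800 : ℤ) = true := by decide +kernel

/-- Kernel check: table keys. -/
theorem keys_table77 : keysOK table77 (52800 : ℤ) = true := by decide

set_option maxRecDepth 100000 in
/-- Kernel check: distance distribution. -/
theorem hist_rows77 : histOK rows77 table77 rows77 = true := by decide +kernel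

set_option maxRecDepth 100000 in
/-- Kernel check: three pairwise-orthogonal nonzero normals of length `24`. -/
theorem normals77_ok : normalsOK normals77 24 = true := by decide +kernel

set_option maxRecDepth 100000 in
/-- Kernel check: rows orthogonal to the normals. -/
theorem orth_rows77 : orthOK normals77 rows77 = true := by decide +kernel

/-- `ι 52800 > 0`. -/
private theorem hq77 : 0 < (Int.castRingHom ℝ) (52800 : ℤ) := by simp

/-- **`A(21, arccos 1/11) ≥ 77`**: the derived code of the Higman–Sims configuration at cosine `1/11` — `77` unit vectors
of `ℝ²¹` with pairwise inner products `1/12` or `-3/8`. [cite: ConwaySloane1999, Ch. 14 Example 3] -/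
theorem exists_code_dim21_eleventh_77 : ∃ C : Finset (EuclideanSpace ℝ (Fin 21)), C.card = 77 ∧
    (∀ x ∈ C, ‖x‖ = 1) ∧ ∀ x ∈ C, ∀ y ∈ C, x ≠ y → inner ℝ x y ≤ 1 / 11 := by
  obtain ⟨C, hc, hn, hi, _⟩ := exists_section Int.cast_injective hq77 shape_rows77 keys_table77 hist_rows77
    (nodup_of_checks shape_rows77 keys_table77 hist_rows77) normals77 normals77_ok orth_rows77 (n := 21)
    (by decide +kernel)
  refine ⟨C, by rw [hc, length_rows77], hn, fun x hx y hy hxy => ?_⟩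
  obtain ⟨p, hp, hpe⟩ := hi x hx y hy hxy
  rw [hpe]
  simp only [table77, List.mem_cons, List.not_mem_nil, or_false] at hp
  rcases hp with rfl | rfl <;> norm_num

/-! ## McLaughlin `112`: second and third derived codes, `A(19, arccos 1/11) ≥ 60`, `A(18, arccos 1/11) ≥ 45` -/

/-- Base points: the first three rows of the `112`-point configuration (pairwise dot product `8`, cosine `1/9`). -/
def xM1 : List ℤ := Dim21Card112.vecs.getD 0 []
/-- Second base point. -/
def xM2 : List ℤ := Dim21Card112.vecs.getD 1 []
/-- Third base point. -/
def xM3 : List ℤ := Dim21Card112.vecs.getD 2 []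

/-- Rows `10z - x₁ - x₂` for the `60` rows `z` with `z·x₁ = z·x₂ = 8`. -/
def rows60 : List (List ℤ) :=
  (Dim21Card112.vecs.filter fun z => dotL xM1 z == 8 && dotL xM2 z == 8).map fun z => comb 10 z (addL xM1 xM2)

/-- Distance table at squared length `7040`: `640` (`45` times), `-2560` (`14` times) — cosines `1/11, -4/11`. -/
def table60 : List (ℤ × ℕ) := [(640, 45), (-2560, 14)]

/-- Normals: the three source normals, `x₁`, and `9x₂ - x₁` (the projection of `x₂`). -/
def normals60 : List (List ℤ) := Dim21Card112.normals ++ [xM1, comb 9 xM2 xM1]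

/-- Kernel check: `60` rows. -/
theorem length_rows60 : rows60.length = 60 := by decide +kernel

set_option maxRecDepth 100000 in
/-- Kernel check: shape. -/
theorem shape_rows60 : shapeOK rows60 24 (7040 : ℤ) = true := by decide +kernel

/-- Kernel check: table keys. -/
theorem keys_table60 : keysOK table60 (7040 : ℤ) = true := by decide

set_option maxRecDepth 100000 in
/-- Kernel check: distance distribution. -/
theorem hist_rows60 : histOK rows60 table60 rows60 = true := by decide +kernel

set_option maxRecDepth 100000 in
/-- Kernel check: five pairwise-orthogonal nonzero normals. -/
theorem normals60_ok : normalsOK normals60 24 = true := by decide +kernel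

set_option maxRecDepth 100000 in
/-- Kernel check: rows orthogonal to the normals. -/
theorem orth_rows60 : orthOK normals60 rows60 = true := by decide +kernel

/-- `ι 7040 > 0`. -/
private theorem hq60 : 0 < (Int.castRingHom ℝ) (7040 : ℤ) := by simp

/-- **`A(19, arccos 1/11) ≥ 60`**: the second derived code of the `112`-point McLaughlin section — `60` unit vectors of
`ℝ¹⁹` with pairwise inner products `1/11` or `-4/11`. [cite: ConwaySloane1999, Ch. 14 Example 3] -/
theorem exists_code_dim19_eleventh_60 : ∃ C : Finset (EuclideanSpace ℝ (Fin 19)), C.card = 60 ∧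
    (∀ x ∈ C, ‖x‖ = 1) ∧ ∀ x ∈ C, ∀ y ∈ C, x ≠ y → inner ℝ x y ≤ 1 / 11 := by
  obtain ⟨C, hc, hn, hi, _⟩ := exists_section Int.cast_injective hq60 shape_rows60 keys_table60 hist_rows60
    (nodup_of_checks shape_rows60 keys_table60 hist_rows60) normals60 normals60_ok orth_rows60 (n := 19)
    (by decide +kernel)
  refine ⟨C, by rw [hc, length_rows60], hn, fun x hx y hy hxy => ?_⟩
  obtain ⟨p, hp, hpe⟩ := hi x hx y hy hxy
  rw [hpe]
  simp only [table60, List.mem_cons, List.not_mem_nil, or_false] at hp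
  rcases hp with rfl | rfl <;> norm_num

/-- **`A(20, arccos 1/11) ≥ 62`** (two poles). [cite: ConwaySloane1999, Ch. 14 Example 3] -/
theorem exists_code_dim20_eleventh_62 : ∃ C : Finset (EuclideanSpace ℝ (Fin 20)), C.card = 62 ∧
    (∀ x ∈ C, ‖x‖ = 1) ∧ ∀ x ∈ C, ∀ y ∈ C, x ≠ y → inner ℝ x y ≤ 1 / 11 := by
  obtain ⟨C, hc, h1, h2⟩ := exists_code_dim19_eleventh_60
  obtain ⟨C', hc', h1', h2'⟩ := SphericalCodes.exists_code_lift_succ (by norm_num) C h1 h2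
  exact ⟨C', by rw [hc', hc], h1', h2'⟩

/-- Rows `11w - x₁ - x₂ - x₃` for the `45` rows `w` with `w·x₁ = w·x₂ = w·x₃ = 8`. -/
def rows45 : List (List ℤ) :=
  (Dim21Card112.vecs.filter fun w => dotL xM1 w == 8 && dotL xM2 w == 8 && dotL xM3 w == 8).map fun w =>
    comb 11 w (addL (addL xM1 xM2) xM3)

/-- Keys at squared length `8448`: `704, -3168` (cosines `1/12, -3/8`; the row histograms are not all equal). -/
def keys45 : List ℤ := [704, -3168]

/-- Normals: those of the `60`-point code and `10x₃ - x₁ - x₂` (the projection of `x₃`). -/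
def normals45 : List (List ℤ) := normals60 ++ [comb 10 xM3 (addL xM1 xM2)]

/-- Kernel check: `45` rows. -/
theorem length_rows45 : rows45.length = 45 := by decide +kernel

set_option maxRecDepth 100000 in
/-- Kernel check: shape. -/
theorem shape_rows45 : shapeOK rows45 24 (8448 : ℤ) = true := by decide +kernel

set_option maxRecDepth 100000 in
/-- Kernel check: all dot products of distinct rows are keys. -/
theorem keys_rows45 : keysRowsOK rows45 keys45 rows45 = true := by decide +kernel

set_option maxRecDepth 100000 in
/-- Kernel check: six pairwise-orthogonal nonzero normals. -/
theorem normals45_ok : normalsOK normals45 24 = true := by decide +kernel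

set_option maxRecDepth 100000 in
/-- Kernel check: rows orthogonal to the normals. -/
theorem orth_rows45 : orthOK normals45 rows45 = true := by decide +kernel

/-- **`A(18, arccos 1/11) ≥ 45`**: the third derived code of the `112`-point section — `45` unit vectors of `ℝ¹⁸` with
pairwise inner products `≤ 1/12`. [cite: ConwaySloane1999, Ch. 14 Example 3] -/
theorem exists_code_dim18_eleventh_45 : ∃ C : Finset (EuclideanSpace ℝ (Fin 18)), C.card = 45 ∧
    (∀ x ∈ C, ‖x‖ = 1) ∧ ∀ x ∈ C, ∀ y ∈ C, x ≠ y → inner ℝ x y ≤ 1 / 11 := by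
  obtain ⟨C, hc, hn, hi⟩ := exists_section_keys (R := ℤ) (ι := Int.castRingHom ℝ) Int.cast_injective (by simp) shape_rows45 keys_rows45 (by decide)
    normals45 normals45_ok orth_rows45 (n := 18) (by decide +kernel) (1 / 11)
    (by intro k hk; simp only [keys45, List.mem_cons, List.not_mem_nil, or_false] at hk
        rcases hk with rfl | rfl <;> norm_num)
  exact ⟨C, by rw [hc, length_rows45], hn, hi⟩

/-! ## The `162`-point section: third derived code, `A(18, arccos 1/10) ≥ 51` -/

/-- Base points: the first three rows of the `162`-point configuration (pairwise dot product `24`, cosine `1/7`). -/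
def xU1 : List ℤ := Dim21Card162.vecs.getD 0 []
/-- Second base point. -/
def xU2 : List ℤ := Dim21Card162.vecs.getD 1 []
/-- Third base point. -/
def xU3 : List ℤ := Dim21Card162.vecs.getD 2 []

/-- Rows `9w - x₁ - x₂ - x₃` for the `51` rows `w` with `w·x₁ = w·x₂ = w·x₃ = 24`. -/
def rows51 : List (List ℤ) :=
  (Dim21Card162.vecs.filter fun w => dotL xU1 w == 24 && dotL xU2 w == 24 && dotL xU3 w == 24).map fun w =>
    comb 9 w (addL (addL xU1 xU2) xU3)

/-- Keys at squared length `12960`: `1296, -4536` (cosines `1/10, -7/20`). -/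
def keys51 : List ℤ := [1296, -4536]

/-- Normals: the three source normals, `x₁`, `7x₂ - x₁`, `8x₃ - x₁ - x₂`. -/
def normals51 : List (List ℤ) := Dim21Card162.normals ++ [xU1, comb 7 xU2 xU1, comb 8 xU3 (addL xU1 xU2)]

/-- Kernel check: `51` rows. -/
theorem length_rows51 : rows51.length = 51 := by decide +kernel

set_option maxRecDepth 100000 in
/-- Kernel check: shape. -/
theorem shape_rows51 : shapeOK rows51 24 (12960 : ℤ) = true := by decide +kernel

set_option maxRecDepth 100000 in
/-- Kernel check: all dot products of distinct rows are keys. -/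
theorem keys_rows51 : keysRowsOK rows51 keys51 rows51 = true := by decide +kernel

set_option maxRecDepth 100000 in
/-- Kernel check: six pairwise-orthogonal nonzero normals. -/
theorem normals51_ok : normalsOK normals51 24 = true := by decide +kernel

set_option maxRecDepth 100000 in
/-- Kernel check: rows orthogonal to the normals. -/
theorem orth_rows51 : orthOK normals51 rows51 = true := by decide +kernel

/-- **`A(18, arccos 1/10) ≥ 51`**: the third derived code of the `162`-point section — `51` unit vectors of `ℝ¹⁸` with
pairwise inner products `≤ 1/10`. [cite: ConwaySloane1999, Ch. 14 Example 3] -/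
theorem exists_code_dim18_tenth_51 : ∃ C : Finset (EuclideanSpace ℝ (Fin 18)), C.card = 51 ∧
    (∀ x ∈ C, ‖x‖ = 1) ∧ ∀ x ∈ C, ∀ y ∈ C, x ≠ y → inner ℝ x y ≤ 1 / 10 := by
  obtain ⟨C, hc, hn, hi⟩ := exists_section_keys (R := ℤ) (ι := Int.castRingHom ℝ) Int.cast_injective (by simp) shape_rows51 keys_rows51 (by decide)
    normals51 normals51_ok orth_rows51 (n := 18) (by decide +kernel) (1 / 10)
    (by intro k hk; simp only [keys51, List.mem_cons, List.not_mem_nil, or_false] at hk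
        rcases hk with rfl | rfl <;> norm_num)
  exact ⟨C, by rw [hc, length_rows51], hn, hi⟩

end Summit.Ventures.PackingBounds.Config.LeechDerived
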